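import Summits.QuantumFields.YangMills.Theses.LangevinControlUV
import Literature.MathematicalPhysics.QuantumLattice.LatticeGaugeDLR

/-!
# Sketch (ideator 2, round 1) for crux `LangevinControlUV.OSLegsFromFemtoAndGap` (stmt-QuantumFields-9367)

First lemmas of the two idea cards filed from this seat:

* `logConvex_bounded_antitone`, `selfImprovingDecay` (PROVED, pure Mathlib): a non-negative
  log-convex sequence dominated by `C θⁿ` is dominated by `g 0 · θⁿ` — under reflection positivity the
  pair-dependent constants of hypothesis H3 / `HasLatticeMassGap` are spurious (card
  `rp-self-improving-shadow-assembly`).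
* `RateOnlyClusteringUpgrade` (Prop): the lattice instantiation for infinite-volume limit states of
  Wilson's measure (positive-time cylinder observables, link reflection about `x₀ = 1/2`).
* `FemtoToBulkTransfer` (Prop): the DECOUPLING statement isolated as the irreducible content of the
  crux — H1's two-sided axis clause with the femto cap `L·a(β) ≤ ℓ₀` replaced by `n·a(β) ≤ ℓ₀/κ` on tori of
  every size `L ≥ κ n`.
* `InfluenceGatedBallCovariance` (Prop): the femto-ball engine inequality of card
  `influence-gated-collar-transfer` — the conditional plaquette–plaquette covariance of Wilson's DLR
  kernel in the ball of radius `κ n`, for EVERY boundary datum `η`, is two-sided around its flat-data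
  value up to a gate read off from the conditional-mean shifts `D_x(η)`.
-/

namespace Summit.QuantumFields.YangMills.Cruxes.OSLegsFromFemtoAndGap.SketchIdeator2

open Filter MeasureTheory
open scoped BigOperators

/-- A non-negative, log-convex (`h (n+1)² ≤ h n · h (n+2)`) and bounded sequence is non-increasing,
hence bounded by its first term. [folklore] -/
theorem logConvex_bounded_antitone {h : ℕ → ℝ} {C : ℝ} (h0 : ∀ n, 0 ≤ h n)
    (hlc : ∀ n, h (n + 1) ^ 2 ≤ h n * h (n + 2)) (hb : ∀ n, h n ≤ C) : ∀ n, h n ≤ h 0 := by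
  have hmono : ∀ m, h (m + 1) ≤ h m := by
    intro m
    by_contra hlt
    push Not at hlt
    have hm_pos : 0 < h m := by
      rcases (h0 m).lt_or_eq with hpos | heq
      · exact hpos
      · exfalso
        have h1 : h (m + 1) ^ 2 ≤ 0 := by
          have := hlc m
          rw [← heq, zero_mul] at this
          exact this
        have h2 : h (m + 1) ^ 2 = 0 := le_antisymm h1 (sq_nonneg _)
        have h3 : h (m + 1) = 0 := (pow_eq_zero_iff two_ne_zero).mp h2
        rw [← heq, h3] at hlt
        exact lt_irrefl _ hlt
    have hm_ne : h m ≠ 0 := hm_pos.ne'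
    set r : ℝ := h (m + 1) / h m with hr
    have hr1 : 1 < r := by rw [hr, one_lt_div hm_pos]; exact hlt
    have hr0 : 0 ≤ r := (zero_lt_one.trans hr1).le
    have key : ∀ k, r ^ k * h m ≤ h (m + k) ∧ r * h (m + k) ≤ h (m + k + 1) := by
      intro k
      induction k with
      | zero =>
        refine ⟨by simp, ?_⟩
        have e : r * h m = h (m + 1) := by rw [hr]; field_simp
        simpa using e.le
      | succ k ih =>
        obtain ⟨ih1, ih2⟩ := ih
        have hk_pos : 0 < h (m + k) := lt_of_lt_of_le (by positivity) ih1
        have hk1 : 0 ≤ h (m + k + 1) := h0 _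
        refine ⟨?_, ?_⟩
        · calc r ^ (k + 1) * h m = r * (r ^ k * h m) := by ring
            _ ≤ r * h (m + k) := mul_le_mul_of_nonneg_left ih1 hr0
            _ ≤ h (m + k + 1) := ih2
        · have lc := hlc (m + k)
          have h4 : r * h (m + k + 1) * h (m + k) ≤ h (m + k + 1) ^ 2 := by
            calc r * h (m + k + 1) * h (m + k) = h (m + k + 1) * (r * h (m + k)) := by ring
              _ ≤ h (m + k + 1) * h (m + k + 1) := mul_le_mul_of_nonneg_left ih2 hk1
              _ = h (m + k + 1) ^ 2 := by ring
          have h5 : r * h (m + k + 1) * h (m + k) ≤ h (m + k + 2) * h (m + k) :=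
            (h4.trans lc).trans_eq (mul_comm _ _)
          exact le_of_mul_le_mul_right h5 hk_pos
    have hbound : ∀ k, r ^ k * h m ≤ C := fun k => (key k).1.trans (hb (m + k))
    have htend : Tendsto (fun k : ℕ => r ^ k * h m) atTop atTop :=
      Filter.Tendsto.atTop_mul_const hm_pos (tendsto_pow_atTop_atTop_of_one_lt hr1)
    obtain ⟨k, hk⟩ := (htend.eventually_gt_atTop C).exists
    exact absurd (hbound k) (not_le.mpr hk)
  intro n
  induction n with
  | zero => exact le_rfl
  | succ n ih => exact (hmono n).trans ih

/-- **Self-improving exponential decay.** If `g ≥ 0` is log-convex and `g n ≤ C θⁿ` for all `n`,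
then `g n ≤ g 0 · θⁿ`: the constant is the diagonal zero-time value. Under reflection positivity,
`g n = ⟨ΘF̄ · τₙF⟩ − |⟨F⟩|²` is log-convex, so exponential clustering at a rate with ANY
pair-dependent constant (hypothesis H3 of the crux, `HasLatticeMassGap`) upgrades to clustering
with constant `‖F̃Ω‖²`, a two-point diagonal quantity. [folklore] -/
theorem selfImprovingDecay {g : ℕ → ℝ} {θ C : ℝ} (hθ : 0 < θ) (hg : ∀ n, 0 ≤ g n)
    (hlc : ∀ n, g (n + 1) ^ 2 ≤ g n * g (n + 2)) (hC : ∀ n, g n ≤ C * θ ^ n) :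
    ∀ n, g n ≤ g 0 * θ ^ n := by
  have key := logConvex_bounded_antitone (h := fun n => g n / θ ^ n) (C := C) ?_ ?_ ?_
  · intro n
    have hn := key n
    simp only [pow_zero, div_one] at hn
    rwa [div_le_iff₀ (pow_pos hθ n)] at hn
  · intro n
    exact div_nonneg (hg n) (pow_pos hθ n).le
  · intro n
    show (g (n + 1) / θ ^ (n + 1)) ^ 2 ≤ g n / θ ^ n * (g (n + 2) / θ ^ (n + 2))
    rw [div_pow, div_mul_div_comm]
    have e : θ ^ n * θ ^ (n + 2) = (θ ^ (n + 1)) ^ 2 := by ring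
    rw [e]
    exact div_le_div_of_nonneg_right (hlc n) (by positivity)
  · intro n
    show g n / θ ^ n ≤ C
    rw [div_le_iff₀ (pow_pos hθ n)]
    exact hC n

open Literature.MathematicalPhysics.QuantumFieldTheory Literature.MathematicalPhysics.QuantumLattice
  Literature.Probability.LatticeModels

/-- **Rate-only clustering upgrades (lattice form).** For every infinite-volume limit state `μ` of
Wilson's measure at `β ≥ 0`, every bounded measurable cylinder observable `F` supported at times
`x₀ ≥ 1`, with `Θ` the link reflection about `x₀ = 1/2` and `τₙ` the time translation: if
`g n = ⟨ΘF · τₙF⟩_μ − ⟨F⟩_μ²` decays like `C e^{-m n}` with SOME constant, then it decays like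
`g 0 · e^{-m n}`. (Content: `g` is log-convex by reflection positivity of limit states —
tree `wilsonExpectation_reflectionPositive_holds` passed to the limit — then `selfImprovingDecay`.)
[cite: OsterwalderSeiler1978, §2] [cite: GlimmJaffe1987, §6.1] -/
def RateOnlyClusteringUpgrade : Prop :=
  ∀ (G : Type) [Group G] [TopologicalSpace G] [IsTopologicalGroup G] [CompactSpace G]
    [MeasurableSpace G] [BorelSpace G] {N : ℕ} (ρ : G →* Matrix (Fin N) (Fin N) ℂ) (β : ℝ), 0 ≤ β →
    ∀ μ ∈ infiniteVolumeLimitPoints (d := 4) ρ β,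
    ∀ (F : LGConfig 4 G → ℝ) (S : Finset (ZdEdge 4)),
      Literature.MathematicalPhysics.QuantumLattice.IsCylinder F S → Measurable F →
      (∃ B : ℝ, ∀ U, |F U| ≤ B) → (∀ e ∈ S, (1 : ℤ) ≤ e.1 0) →
      let θ : LGConfig 4 G → LGConfig 4 G := fun U e =>
        if e.2 = 0 then (U (Function.update e.1 0 (-(e.1 0)), 0))⁻¹
        else U (Function.update e.1 0 (1 - e.1 0), e.2)
      let g : ℕ → ℝ := fun n =>
        (∫ U, F (θ U) * F (configShift (-(Pi.single (0 : Fin 4) (n : ℤ))) U) ∂μ) - (∫ U, F U ∂μ) ^ 2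
      ∀ (m C : ℝ), 0 < m → (∀ n : ℕ, |g n| ≤ C * Real.exp (-(m * n))) →
        ∀ n : ℕ, g n ≤ g 0 * Real.exp (-(m * n))

/-- **FemtoToBulkTransfer (the decoupling statement D).** For every compact simple `G`, faithful `r`
and unit map `a` carrying the femto two-point package of `FemtoCurvatureTwoPoint` (hypothesis H1 of
the crux) with data `Γ, β₀, ℓ₀, c, C`, and every margin `κ ≥ 8`: the two-sided axis bound persists
on periodic tori of EVERY size `L ≥ κ n` (no femto cap on `L`), for separations with
`n · a(β) ≤ ℓ₀ / κ`, with new constants `c', C'`. This is the leg of the crux that neither the femto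
hypotheses nor the gap hypothesis reach; cards 1–2 of this seat reduce the crux to it (plus the
8646-type E0′/E1 legs) and attack it. [conjecture] -/
def FemtoToBulkTransfer : Prop :=
  ∀ (G : Type) [Group G] [TopologicalSpace G] [IsTopologicalGroup G] [CompactSpace G],
    IsCompactSimpleLieGroup G → letI : MeasurableSpace G := borel G; haveI : BorelSpace G := ⟨rfl⟩;
    ∀ (r : LatticeRep G) (a : ℝ → ℝ) (Γ : ℝ → ℝ) (β₀ ℓ₀ c C : ℝ),
    (0 < ℓ₀ ∧ 0 < c ∧ (∀ β, 0 < a β) ∧ Filter.Tendsto a Filter.atTop (nhds 0) ∧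
      (∀ s : ℝ, 0 < s → s ≤ ℓ₀ → 0 < Γ s ∧ Γ s ≤ 1) ∧
      ∀ (L : ℕ) [NeZero L] (β : ℝ), β₀ ≤ β → (L : ℝ) * a β ≤ ℓ₀ →
        let P : (Fin 4 → ZMod L) → Fin 4 → Fin 4 → GaugeConfig 4 L G → ℝ :=
          fun x i j U => (r.N : ℝ) - (r.ρ (plaquetteHolonomy U x i j)).trace.re
        let E : (GaugeConfig 4 L G → ℝ) → ℝ := fun F => wilsonExpectation (d := 4) (L := L) r.ρ β F
        let cov : (GaugeConfig 4 L G → ℝ) → (GaugeConfig 4 L G → ℝ) → ℝ :=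
          fun F F' => E (fun U => F U * F' U) - E F * E F'
        let dist : (Fin 4 → ZMod L) → (Fin 4 → ZMod L) → ℝ :=
          fun x y => Real.sqrt (∑ k : Fin 4, (((x k - y k).valMinAbs : ℤ) : ℝ) ^ 2)
        (∀ n : ℕ, 1 ≤ n → 8 * n ≤ L →
            c * Γ ((n : ℝ) * a β) ≤ (n : ℝ) ^ 8 * cov (P 0 0 1) (P (Pi.single (2 : Fin 4) ((n : ℕ) : ZMod L)) 0 1) ∧
            (n : ℝ) ^ 8 * cov (P 0 0 1) (P (Pi.single (2 : Fin 4) ((n : ℕ) : ZMod L)) 0 1) ≤ C * Γ ((n : ℝ) * a β)) ∧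
        (∀ (x y : Fin 4 → ZMod L) (i j i' j' : Fin 4), x ≠ y → i ≠ j → i' ≠ j' →
            |cov (P x i j) (P y i' j')| * dist x y ^ 8 ≤ C * Γ (dist x y * a β))) →
    ∀ κ : ℕ, 8 ≤ κ →
      ∃ (c' C' β' : ℝ), 0 < c' ∧ ∀ (L : ℕ) [NeZero L] (β : ℝ), β' ≤ β →
        let P : (Fin 4 → ZMod L) → Fin 4 → Fin 4 → GaugeConfig 4 L G → ℝ :=
          fun x i j U => (r.N : ℝ) - (r.ρ (plaquetteHolonomy U x i j)).trace.re
        let E : (GaugeConfig 4 L G → ℝ) → ℝ := fun F => wilsonExpectation (d := 4) (L := L) r.ρ β F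
        let cov : (GaugeConfig 4 L G → ℝ) → (GaugeConfig 4 L G → ℝ) → ℝ :=
          fun F F' => E (fun U => F U * F' U) - E F * E F'
        ∀ n : ℕ, 1 ≤ n → κ * n ≤ L → (n : ℝ) * a β ≤ ℓ₀ / κ →
          c' * Γ ((n : ℝ) * a β) ≤ (n : ℝ) ^ 8 * cov (P 0 0 1) (P (Pi.single (2 : Fin 4) ((n : ℕ) : ZMod L)) 0 1) ∧
            (n : ℝ) ^ 8 * cov (P 0 0 1) (P (Pi.single (2 : Fin 4) ((n : ℕ) : ZMod L)) 0 1) ≤ C' * Γ ((n : ℝ) * a β)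

/-- **Influence-gated ball covariance (femto-ball engine inequality, ALL boundary data).** For every
compact simple `G`, faithful `r` and margin `κ ≥ 8` there are `C, β₀, n₀` such that for `β ≥ β₀`,
`n ≥ n₀`, with `Λ` the edges based in the cube `{-κn,…,κn}⁴`, `ν_η` Wilson's DLR kernel
`ymSpecification r.ρ β Λ η`, `P_x = N − Re tr r(U_{x,01})`, `K(η) = Cov_{ν_η}(P_0, P_{n e₂})` and
`D_x(η) = ∫P_x dν_η − ∫P_x dν_1` (conditional-mean shift against FLAT Dirichlet data): for every
boundary datum `η` whose shifts obey `|D_x(η)| ≤ M` on the inner cube `{-2n,…,2n}⁴`,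
`K(1)·(1 − C(M/√K(1) + κ⁻⁴)) ≤ K(η) ≤ C·K(1)·(1 + M/√K(1))` — SCALE-FREE: no `β`, no power of
`n` (`M` and `√K(1)` are both fourth-order lattice quantities, `M/√K(1) ≍ (g²(R)/g²(n))(n/R)⁴`). The
exterior enters a fixed-separation conditional covariance only through the background it induces,
whose strength is certified by the one-point shifts themselves (second order in the background, like
the covariance contamination); exact for Gaussian/abelian proxies (`C = 2√2`). [conjecture] -/
def InfluenceGatedBallCovariance : Prop :=
  ∀ (G : Type) [Group G] [TopologicalSpace G] [IsTopologicalGroup G] [CompactSpace G]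
    [MeasurableSpace G] [BorelSpace G], IsCompactSimpleLieGroup G →
    ∀ (r : LatticeRep G) (κ : ℕ), 8 ≤ κ →
      ∃ (C β₀ : ℝ) (n₀ : ℕ), ∀ β : ℝ, β₀ ≤ β → ∀ n : ℕ, n₀ ≤ n →
        let Λ : Finset (ZdEdge 4) := box 4 (κ * n) ×ˢ (Finset.univ : Finset (Fin 4))
        let ν : LGConfig 4 G → Measure (LGConfig 4 G) := fun η => ymSpecification r.ρ β Λ η
        let P : Site 4 → LGConfig 4 G → ℝ := fun x U => (r.N : ℝ) - plaquetteObs r.ρ x 0 1 U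
        let y : Site 4 := Pi.single (2 : Fin 4) (n : ℤ)
        let K : LGConfig 4 G → ℝ := fun η =>
          (∫ U, P 0 U * P y U ∂(ν η)) - (∫ U, P 0 U ∂(ν η)) * ∫ U, P y U ∂(ν η)
        let D : Site 4 → LGConfig 4 G → ℝ := fun x η => (∫ U, P x U ∂(ν η)) - ∫ U, P x U ∂(ν 1)
        ∀ (η : LGConfig 4 G) (M : ℝ), (∀ x ∈ box 4 (2 * n), |D x η| ≤ M) →
          K 1 * (1 - C * (M / Real.sqrt (K 1) + 1 / (κ : ℝ) ^ 4)) ≤ K η ∧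
            K η ≤ C * K 1 * (1 + M / Real.sqrt (K 1))

end Summit.QuantumFields.YangMills.Cruxes.OSLegsFromFemtoAndGap.SketchIdeator2
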